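import Mathlib
import Literature.Analysis.UnboundedOperators.ConjugateOperatorRegularity
import Literature.Analysis.UnboundedOperators.UnitaryRepSpectralMeasure
import Literature.Analysis.UnboundedOperators.FourierSpectrumCalculus
import HarnessLib
import Summits.AtomisticToContinuum.FouriersLaw.Theorems.EmbeddedDrudeMourreMourreDissolutionLAPSymbolExp
import Summits.AtomisticToContinuum.FouriersLaw.Theorems.EmbeddedDrudeMourreMourreDissolutionLAPCutoffRegularity

/-!
# Stub `stub_mourreThresholdLAP` — F3a (part 2/2): energy localisation and plateau cutoffs

Item `stmt-AtomisticToContinuum-12594` (crux `MourreDissolution` of route `EmbeddedDrudeMourre`,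
sub-problem `FouriersLaw`), line `separable-vertex-faddeev-pair-sector`, stub S6
`stub_mourreThresholdLAP` (Mourre's limiting absorption principle, `C²` form), helper F3a of the
proof map, part 2/2 (the spectral side; part 1/2 `…LAPMourreCommutatorForm` is the `C¹(A)`
algebra of the Mourre commutator).

Setting: `U(t) = e^{itH}`, `R(z) = resolventAt U z = (H - z)⁻¹` (symbol `(ξ - z)⁻¹` on the Stone–Bochner
measures `μ_v = specMeasure U v`), `Φ = U.fourierCalculus g = φ(H)` (`φ = g(·/2π)`, symbol `g(ξ/2π)`).

* §1 the symbol data of `φ(H)`, `1 - φ(H)`; `‖P v‖² = ∫ p² dμ_v` and the SANDWICH FORMULA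
  `‖P R(z) v‖² = ∫ p(ξ)² / ((ξ - Re z)² + (Im z)²) dμ_v(ξ)` for a self-adjoint `P = c·1 + U[k]`
  with real symbol `p` (`(P R)†(P R) = R(z̄) P P R(z)` has symbol `|ξ - z|⁻² p²`); `‖φ(H)‖ ≤ 1`;
* §2 ENERGY LOCALISATION (smooth-cutoff form of ABG Lemma 7.3.2 / (7.3.3)): if `0 ≤ φ ≤ 1` and
  `φ ≡ 1` on `[ω - δ', ω + δ']`, then for `Re z = ω`, `Im z ≠ 0`:
  `‖R(z)v‖² - ‖Φ R(z) v‖² ≤ δ'⁻² ‖v‖²`, `‖(1 - Φ) R(z) v‖ ≤ δ'⁻¹ ‖v‖`, `‖(1 - Φ) R(z)‖ ≤ δ'⁻¹`;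
* §3 PLATEAU CUTOFFS EXIST: for `l < l₁ ≤ r₁ < r` an admissible real cutoff `g` on `(l, r)` with
  `0 ≤ g ≤ 1` and `g(x/2π) = 1` on `[l₁, r₁]` (a `ContDiffBump` in energy, rescaled by `2π`);
* §4 the headline `energyLocalisation_of_plateauCutoff`.
-/

noncomputable section

open MeasureTheory Complex Filter Topology Set
open scoped InnerProductSpace ComplexConjugate SchwartzMap FourierTransform ENNReal NNReal

namespace Summit.AtomisticToContinuum.FouriersLaw.Theorems.MourreDissolution

open Literature.Analysis.UnboundedOperators
open Literature.Analysis.UnboundedOperators.UnitaryRep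

variable {H : Type*} [NormedAddCommGroup H] [InnerProductSpace ℂ H] [CompleteSpace H]

/-! ## §1. The symbol of `φ(H)` and the sandwich formula `‖P R(z) v‖² = ∫ p²|ξ - z|⁻² dμ_v` -/

/-- **The symbol datum of `g(H/2π)`**: `(0, 𝓕g)` has operator `U[𝓕g] = g(H/2π)` and symbol
`ξ ↦ g(ξ/2π)` (Fourier inversion). [folklore] -/
theorem exists_cutoffDatum (g : 𝓢(ℝ, ℂ)) :
    ∃ d : SymbolDatum, (∀ U : OneParameterUnitaryGroup H, d.op U = U.fourierCalculus g) ∧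
      ∀ ξ : ℝ, d.fn ξ = g (ξ / (2 * Real.pi)) := by
  refine ⟨⟨0, fun a => (𝓕 g : 𝓢(ℝ, ℂ)) a, (𝓕 g : 𝓢(ℝ, ℂ)).integrable⟩, fun U => ?_, fun ξ => ?_⟩
  · rw [SymbolDatum.op, zero_smul, zero_add]
    rfl
  · rw [SymbolDatum.fn, zero_add]
    exact integral_fourier_mul_cexp g ξ

/-- **The symbol datum of `1 - g(H/2π)`**: `(1, -𝓕g)` has operator `1 - g(H/2π)` and symbol
`ξ ↦ 1 - g(ξ/2π)`. [folklore] -/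
theorem exists_complCutoffDatum (g : 𝓢(ℝ, ℂ)) :
    ∃ d : SymbolDatum, (∀ U : OneParameterUnitaryGroup H, d.op U = 1 - U.fourierCalculus g) ∧
      ∀ ξ : ℝ, d.fn ξ = 1 - g (ξ / (2 * Real.pi)) := by
  obtain ⟨d, hop, hfn⟩ := exists_cutoffDatum (H := H) g
  refine ⟨SymbolDatum.one.add (SymbolDatum.smul (-1) d), fun U => ?_, fun ξ => ?_⟩
  · rw [SymbolDatum.op_add, SymbolDatum.op_smul, SymbolDatum.op_one, hop, neg_one_smul, sub_eq_add_neg]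
  · rw [SymbolDatum.fn_add, SymbolDatum.fn_smul, SymbolDatum.fn_one, hfn, neg_one_mul, sub_eq_add_neg]

/-- `∫ f dμ_v ≤ C ‖v‖²` when `f ≤ C` pointwise (`μ_v(ℝ) = ‖v‖²`). [folklore] -/
theorem integral_specMeasure_le (U : OneParameterUnitaryGroup H) (v : H) {f : ℝ → ℝ} {C : ℝ}
    (hf : Integrable f (specMeasure U v)) (h : ∀ ξ, f ξ ≤ C) :
    ∫ ξ, f ξ ∂(specMeasure U v) ≤ C * ‖v‖ ^ 2 := by
  calc ∫ ξ, f ξ ∂(specMeasure U v) ≤ ∫ _ξ, C ∂(specMeasure U v) :=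
        integral_mono hf (integrable_const _) h
    _ = C * ‖v‖ ^ 2 := by rw [integral_const, specMeasure_real_univ, smul_eq_mul, mul_comm]

/-- **Norms through the symbol**: for a self-adjoint element `P = d.op U` of the unital smeared
group algebra with real symbol `p = d.fn`, the function `p²` is `μ_v`-integrable and
`‖P v‖² = ∫ p(ξ)² dμ_v(ξ)` (`⟪P v, P v⟫ = ⟪v, P P v⟫` and the product rule `inner_op_eq`).
[folklore] -/
theorem norm_sq_op_apply (U : OneParameterUnitaryGroup H) (d : SymbolDatum)
    (hP : IsSelfAdjoint (d.op U)) (hd : ∀ ξ, conj (d.fn ξ) = d.fn ξ) (v : H) :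
    Integrable (fun ξ : ℝ => (d.fn ξ).re ^ 2) (specMeasure U v) ∧
      ‖d.op U v‖ ^ 2 = ∫ ξ, (d.fn ξ).re ^ 2 ∂(specMeasure U v) := by
  have hfn : ∀ ξ : ℝ, (d.mul d).fn ξ = (((d.fn ξ).re ^ 2 : ℝ) : ℂ) := fun ξ => by
    set p : ℝ := (d.fn ξ).re with hp
    have hre : d.fn ξ = (p : ℂ) := (Complex.conj_eq_iff_re.1 (hd ξ)).symm
    rw [SymbolDatum.fn_mul, hre]
    push_cast
    ring
  have hre : ∀ ξ : ℝ, RCLike.re ((d.mul d).fn ξ) = (d.fn ξ).re ^ 2 := fun ξ => by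
    rw [hfn, RCLike.re_to_complex, Complex.ofReal_re]
  refine ⟨(((d.mul d).integrable_fn U v).re).congr (ae_of_all _ fun ξ => hre ξ), ?_⟩
  have hsym : ∀ u w : H, ⟪d.op U u, w⟫_ℂ = ⟪u, d.op U w⟫_ℂ := fun u w => by
    rw [← ContinuousLinearMap.adjoint_inner_right, hP.adjoint_eq]
  have h1 : ‖d.op U v‖ ^ 2 = (⟪v, (d.mul d).op U v⟫_ℂ).re := by
    rw [SymbolDatum.op_mul, mul_apply_eq_comp, ← hsym, inner_self_eq_norm_sq_to_K]
    norm_cast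
  rw [h1, SymbolDatum.inner_op_eq, ← RCLike.re_to_complex, ← integral_re ((d.mul d).integrable_fn U v)]
  exact integral_congr_ae (ae_of_all _ fun ξ => hre ξ)

/-- **`‖g(H/2π) v‖ ≤ ‖v‖`** for a real symbol with `0 ≤ g ≤ 1`. [folklore] -/
theorem norm_cutoff_apply_le (U : OneParameterUnitaryGroup H) {g : 𝓢(ℝ, ℂ)}
    (hg : ∀ ξ, conj (g ξ) = g ξ) (h01 : ∀ ξ, 0 ≤ (g ξ).re ∧ (g ξ).re ≤ 1) (v : H) :
    ‖U.fourierCalculus g v‖ ≤ ‖v‖ := by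
  obtain ⟨d, hop, hfn⟩ := exists_cutoffDatum (H := H) g
  obtain ⟨hi, he⟩ := norm_sq_op_apply U d (by rw [hop]; exact isSelfAdjoint_fourierCalculus U hg)
    (fun ξ => by rw [hfn, hg]) v
  rw [hop] at he
  simp only [hfn] at hi he
  have hsq : ‖U.fourierCalculus g v‖ ^ 2 ≤ 1 * ‖v‖ ^ 2 := by
    rw [he]
    refine integral_specMeasure_le U v hi fun ξ => ?_
    obtain ⟨h0, h1⟩ := h01 (ξ / (2 * Real.pi))
    nlinarith
  exact (sq_le_sq₀ (norm_nonneg _) (norm_nonneg _)).1 (by rwa [one_mul] at hsq)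

/-- **`‖v - g(H/2π) v‖ ≤ ‖v‖`** for a real symbol with `0 ≤ g ≤ 1`. [folklore] -/
theorem norm_sub_cutoff_apply_le (U : OneParameterUnitaryGroup H) {g : 𝓢(ℝ, ℂ)}
    (hg : ∀ ξ, conj (g ξ) = g ξ) (h01 : ∀ ξ, 0 ≤ (g ξ).re ∧ (g ξ).re ≤ 1) (v : H) :
    ‖v - U.fourierCalculus g v‖ ≤ ‖v‖ := by
  obtain ⟨d, hop, hfn⟩ := exists_complCutoffDatum (H := H) g
  obtain ⟨hi, he⟩ := norm_sq_op_apply U d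
    (by rw [hop]; exact (IsSelfAdjoint.one _).sub (isSelfAdjoint_fourierCalculus U hg))
    (fun ξ => by rw [hfn, map_sub, map_one, hg]) v
  rw [hop] at he
  simp only [hfn, _root_.sub_apply, one_apply_eq_self, Complex.sub_re,
    Complex.one_re] at hi he
  have hsq : ‖v - U.fourierCalculus g v‖ ^ 2 ≤ 1 * ‖v‖ ^ 2 := by
    rw [he]
    refine integral_specMeasure_le U v hi fun ξ => ?_
    obtain ⟨h0, h1⟩ := h01 (ξ / (2 * Real.pi))
    nlinarith
  exact (sq_le_sq₀ (norm_nonneg _) (norm_nonneg _)).1 (by rwa [one_mul] at hsq)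

/-- **`‖g(H/2π)‖ ≤ 1` and `‖1 - g(H/2π)‖ ≤ 1`** for a real symbol with `0 ≤ g ≤ 1`. [folklore] -/
theorem norm_cutoff_le_one (U : OneParameterUnitaryGroup H) {g : 𝓢(ℝ, ℂ)}
    (hg : ∀ ξ, conj (g ξ) = g ξ) (h01 : ∀ ξ, 0 ≤ (g ξ).re ∧ (g ξ).re ≤ 1) :
    ‖U.fourierCalculus g‖ ≤ 1 ∧ ‖1 - U.fourierCalculus g‖ ≤ 1 := by
  refine ⟨ContinuousLinearMap.opNorm_le_bound _ zero_le_one fun v => ?_,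
    ContinuousLinearMap.opNorm_le_bound _ zero_le_one fun v => ?_⟩
  · rw [one_mul]
    exact norm_cutoff_apply_le U hg h01 v
  · rw [one_mul, _root_.sub_apply, one_apply_eq_self]
    exact norm_sub_cutoff_apply_le U hg h01 v

/-- `(ξ - z̄)(ξ - z) = (ξ - Re z)² + (Im z)²` for real `ξ`. [folklore] -/
theorem sub_conj_mul_sub (ξ : ℝ) (z : ℂ) :
    ((ξ : ℂ) - conj z) * ((ξ : ℂ) - z) = (((ξ - z.re) ^ 2 + z.im ^ 2 : ℝ) : ℂ) := by
  apply Complex.ext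
  · simp only [Complex.mul_re, Complex.sub_re, Complex.sub_im, Complex.ofReal_re, Complex.ofReal_im,
      Complex.conj_re, Complex.conj_im]
    ring
  · simp only [Complex.mul_im, Complex.sub_re, Complex.sub_im, Complex.ofReal_re, Complex.ofReal_im,
      Complex.conj_re, Complex.conj_im]
    ring

/-- **The sandwich `R(z̄) P P R(z)` as a symbol datum**: for a datum `d` with real symbol `p` and
non-real `z` there is a datum with operator `R(z̄) (P (P R(z)))` (`P = d.op`) and symbol
`p(ξ)² / ((ξ - Re z)² + (Im z)²)` (product rule of the symbol calculus). [folklore] -/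
theorem exists_sandwichDatum (d : SymbolDatum) (hd : ∀ ξ, conj (d.fn ξ) = d.fn ξ) {z : ℂ}
    (hz : z.im ≠ 0) :
    ∃ D : SymbolDatum,
      (∀ U : OneParameterUnitaryGroup H,
          D.op U = resolventAt U (conj z) * (d.op U * (d.op U * resolventAt U z))) ∧
        ∀ ξ : ℝ, D.fn ξ = (((d.fn ξ).re ^ 2 / ((ξ - z.re) ^ 2 + z.im ^ 2) : ℝ) : ℂ) := by
  have hz' : (conj z).im ≠ 0 := by rw [Complex.conj_im]; exact neg_ne_zero.2 hz
  refine ⟨(resolventDatum hz').mul (d.mul (d.mul (resolventDatum hz))), fun U => ?_, fun ξ => ?_⟩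
  · rw [SymbolDatum.op_mul, SymbolDatum.op_mul, SymbolDatum.op_mul, resolventDatum_op,
      resolventDatum_op]
  · rw [SymbolDatum.fn_mul, SymbolDatum.fn_mul, SymbolDatum.fn_mul, resolventDatum_fn,
      resolventDatum_fn]
    set p : ℝ := (d.fn ξ).re with hp
    have hre : d.fn ξ = (p : ℂ) := (Complex.conj_eq_iff_re.1 (hd ξ)).symm
    have h1 : (ξ : ℂ) - conj z ≠ 0 := fun h => hz (by simpa using congrArg Complex.im h)
    have h2 : (ξ : ℂ) - z ≠ 0 := fun h => hz (by simpa using congrArg Complex.im h)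
    rw [hre]
    calc 1 / ((ξ : ℂ) - conj z) * ((p : ℂ) * ((p : ℂ) * (1 / ((ξ : ℂ) - z))))
        = (p : ℂ) ^ 2 / (((ξ : ℂ) - conj z) * ((ξ : ℂ) - z)) := by
          field_simp
      _ = _ := by
          rw [sub_conj_mul_sub]
          push_cast
          ring

/-- **`‖P u‖² = Re ⟪u, P (P u)⟫` … the sandwich formula**: for a self-adjoint element `P = d.op U`
of the unital smeared group algebra with real symbol `p = d.fn`, every non-real `z` and every `v`,
the function `ξ ↦ p(ξ)² / ((ξ - Re z)² + (Im z)²)` is `μ_v`-integrable and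
`‖P (R(z) v)‖² = ∫ p(ξ)² / ((ξ - Re z)² + (Im z)²) dμ_v(ξ)`
(`⟪P R v, P R v⟫ = ⟪v, R(z̄) P P R(z) v⟫` and `inner_op_eq`). [folklore] -/
theorem norm_sq_op_resolventAt (U : OneParameterUnitaryGroup H) (d : SymbolDatum)
    (hP : IsSelfAdjoint (d.op U)) (hd : ∀ ξ, conj (d.fn ξ) = d.fn ξ) {z : ℂ} (hz : z.im ≠ 0)
    (v : H) :
    Integrable (fun ξ : ℝ => (d.fn ξ).re ^ 2 / ((ξ - z.re) ^ 2 + z.im ^ 2)) (specMeasure U v) ∧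
      ‖d.op U (resolventAt U z v)‖ ^ 2 =
        ∫ ξ, (d.fn ξ).re ^ 2 / ((ξ - z.re) ^ 2 + z.im ^ 2) ∂(specMeasure U v) := by
  obtain ⟨D, hop, hfn⟩ := exists_sandwichDatum (H := H) d hd hz
  have hre : ∀ ξ : ℝ, RCLike.re (D.fn ξ) = (d.fn ξ).re ^ 2 / ((ξ - z.re) ^ 2 + z.im ^ 2) :=
    fun ξ => by rw [hfn, RCLike.re_to_complex, Complex.ofReal_re]
  refine ⟨((D.integrable_fn U v).re).congr (ae_of_all _ fun ξ => hre ξ), ?_⟩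
  have hsym : ∀ u w : H, ⟪d.op U u, w⟫_ℂ = ⟪u, d.op U w⟫_ℂ := fun u w => by
    rw [← ContinuousLinearMap.adjoint_inner_right, hP.adjoint_eq]
  have h1 : ‖d.op U (resolventAt U z v)‖ ^ 2 = (⟪v, D.op U v⟫_ℂ).re := by
    rw [hop U, mul_apply_eq_comp, mul_apply_eq_comp, mul_apply_eq_comp,
      ← inner_resolventAt_left hz U, ← hsym, inner_self_eq_norm_sq_to_K]
    norm_cast
  rw [h1, SymbolDatum.inner_op_eq, ← RCLike.re_to_complex, ← integral_re (D.integrable_fn U v)]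
  exact integral_congr_ae (ae_of_all _ fun ξ => hre ξ)

/-! ## §2. Energy localisation for a plateau cutoff -/

/-- The elementary bound behind energy localisation: if `n ≤ 1` and `n = 0` whenever
`|ξ - ω| ≤ δ'`, then `n / ((ξ - ω)² + s) ≤ δ'⁻²` for `s ≥ 0`. [folklore] -/
theorem plateau_div_le {n ξ ω s δ' : ℝ} (hδ : 0 < δ') (hn1 : n ≤ 1) (hs : 0 ≤ s)
    (hplat : |ξ - ω| ≤ δ' → n = 0) : n / ((ξ - ω) ^ 2 + s) ≤ δ'⁻¹ ^ 2 := by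
  by_cases h : |ξ - ω| ≤ δ'
  · rw [hplat h, zero_div]
    positivity
  · rw [not_le] at h
    have h2 : δ' ^ 2 < (ξ - ω) ^ 2 := by
      calc δ' ^ 2 < |ξ - ω| ^ 2 := by gcongr
        _ = (ξ - ω) ^ 2 := sq_abs _
    have h3 : 0 < (ξ - ω) ^ 2 + s := by nlinarith
    calc n / ((ξ - ω) ^ 2 + s) ≤ 1 / ((ξ - ω) ^ 2 + s) := by gcongr
      _ ≤ 1 / δ' ^ 2 := by
          apply one_div_le_one_div_of_le (by positivity)
          linarith
      _ = δ'⁻¹ ^ 2 := by rw [one_div, inv_pow]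

/-- **Energy localisation, quadratic form** (smooth-cutoff form of ABG (7.3.3)): if `g` is real with
`0 ≤ g ≤ 1` and `g(x/2π) = 1` for `x ∈ [ω - δ', ω + δ']`, then for every `z` with `Re z = ω`,
`Im z ≠ 0` and every `v`,
`‖R(z) v‖² - ‖Φ (R(z) v)‖² ≤ δ'⁻² ‖v‖²` (`Φ = g(H/2π)`): on the spectral side the left member is
`∫ (1 - φ(ξ)²)/|ξ - z|² dμ_v(ξ)`, whose integrand vanishes where `|ξ - ω| ≤ δ'` and is `≤ δ'⁻²`
elsewhere, while `μ_v(ℝ) = ‖v‖²`. [cite: AmreinBoutetdeMonvelGeorgescu1996, Lemma 7.3.2 eq. (7.3.3)] -/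
theorem norm_sq_resolventAt_sub_norm_sq_cutoff_le (U : OneParameterUnitaryGroup H) {g : 𝓢(ℝ, ℂ)}
    (hg : ∀ ξ, conj (g ξ) = g ξ) (h01 : ∀ ξ, 0 ≤ (g ξ).re ∧ (g ξ).re ≤ 1) {ω δ' : ℝ} (hδ : 0 < δ')
    (hplat : ∀ x ∈ Set.Icc (ω - δ') (ω + δ'), g (x / (2 * Real.pi)) = 1) {z : ℂ} (hz : z.im ≠ 0)
    (hω : z.re = ω) (v : H) :
    ‖resolventAt U z v‖ ^ 2 - ‖U.fourierCalculus g (resolventAt U z v)‖ ^ 2 ≤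
      δ'⁻¹ ^ 2 * ‖v‖ ^ 2 := by
  -- `‖R v‖² = ∫ |ξ - z|⁻²`
  obtain ⟨hi₁, he₁⟩ := norm_sq_op_resolventAt U SymbolDatum.one
    (by rw [SymbolDatum.op_one]; exact IsSelfAdjoint.one _)
    (fun ξ => by rw [SymbolDatum.fn_one, map_one]) hz v
  rw [SymbolDatum.op_one, one_apply_eq_self] at he₁
  simp only [SymbolDatum.fn_one, Complex.one_re, one_pow] at hi₁ he₁
  -- `‖Φ R v‖² = ∫ φ² |ξ - z|⁻²`
  obtain ⟨d, hop, hfn⟩ := exists_cutoffDatum (H := H) g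
  obtain ⟨hi₂, he₂⟩ := norm_sq_op_resolventAt U d (by rw [hop]; exact isSelfAdjoint_fourierCalculus U hg)
    (fun ξ => by rw [hfn, hg]) hz v
  rw [hop] at he₂
  simp only [hfn] at hi₂ he₂
  have hpt : ∀ ξ : ℝ, 1 / ((ξ - z.re) ^ 2 + z.im ^ 2) -
      (g (ξ / (2 * Real.pi))).re ^ 2 / ((ξ - z.re) ^ 2 + z.im ^ 2) ≤ δ'⁻¹ ^ 2 := fun ξ => by
    rw [← sub_div, hω]
    obtain ⟨h0, h1⟩ := h01 (ξ / (2 * Real.pi))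
    refine plateau_div_le hδ (by nlinarith) (sq_nonneg _) fun hξ => ?_
    rw [hplat ξ (by rw [Set.mem_Icc]; constructor <;> linarith [abs_le.1 hξ]), Complex.one_re]
    ring
  rw [he₁, he₂, ← integral_sub hi₁ hi₂]
  exact integral_specMeasure_le U v (hi₁.sub hi₂) hpt

/-- **Energy localisation, norm form**: under the same hypotheses,
`‖R(z) v - Φ (R(z) v)‖ ≤ δ'⁻¹ ‖v‖`, i.e. `‖(1 - φ(H)) R(z)‖ ≤ 1/δ'` (spectral side:
`(1 - φ(ξ))²/|ξ - z|² ≤ δ'⁻²`). [cite: AmreinBoutetdeMonvelGeorgescu1996, Lemma 7.3.2 eq. (7.3.3)] -/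
theorem norm_resolventAt_sub_cutoff_le (U : OneParameterUnitaryGroup H) {g : 𝓢(ℝ, ℂ)}
    (hg : ∀ ξ, conj (g ξ) = g ξ) (h01 : ∀ ξ, 0 ≤ (g ξ).re ∧ (g ξ).re ≤ 1) {ω δ' : ℝ} (hδ : 0 < δ')
    (hplat : ∀ x ∈ Set.Icc (ω - δ') (ω + δ'), g (x / (2 * Real.pi)) = 1) {z : ℂ} (hz : z.im ≠ 0)
    (hω : z.re = ω) (v : H) :
    ‖resolventAt U z v - U.fourierCalculus g (resolventAt U z v)‖ ≤ δ'⁻¹ * ‖v‖ := by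
  obtain ⟨d, hop, hfn⟩ := exists_complCutoffDatum (H := H) g
  obtain ⟨hi, he⟩ := norm_sq_op_resolventAt U d
    (by rw [hop]; exact (IsSelfAdjoint.one _).sub (isSelfAdjoint_fourierCalculus U hg))
    (fun ξ => by rw [hfn, map_sub, map_one, hg]) hz v
  rw [hop] at he
  simp only [hfn, _root_.sub_apply, one_apply_eq_self, Complex.sub_re,
    Complex.one_re] at hi he
  have hsq : ‖resolventAt U z v - U.fourierCalculus g (resolventAt U z v)‖ ^ 2 ≤
      (δ'⁻¹ * ‖v‖) ^ 2 := by
    rw [he, mul_pow]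
    refine integral_specMeasure_le U v hi fun ξ => ?_
    rw [hω]
    obtain ⟨h0, h1⟩ := h01 (ξ / (2 * Real.pi))
    refine plateau_div_le hδ (by nlinarith) (sq_nonneg _) fun hξ => ?_
    rw [hplat ξ (by rw [Set.mem_Icc]; constructor <;> linarith [abs_le.1 hξ]), Complex.one_re]
    ring
  exact (sq_le_sq₀ (norm_nonneg _) (by positivity)).1 hsq

/-- **`‖(1 - φ(H)) R(z)‖ ≤ 1/δ'`** (operator-norm form of energy localisation).
[cite: AmreinBoutetdeMonvelGeorgescu1996, Lemma 7.3.2 eq. (7.3.3)] -/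
theorem norm_one_sub_cutoff_mul_resolventAt_le (U : OneParameterUnitaryGroup H) {g : 𝓢(ℝ, ℂ)}
    (hg : ∀ ξ, conj (g ξ) = g ξ) (h01 : ∀ ξ, 0 ≤ (g ξ).re ∧ (g ξ).re ≤ 1) {ω δ' : ℝ} (hδ : 0 < δ')
    (hplat : ∀ x ∈ Set.Icc (ω - δ') (ω + δ'), g (x / (2 * Real.pi)) = 1) {z : ℂ} (hz : z.im ≠ 0)
    (hω : z.re = ω) :
    ‖(1 - U.fourierCalculus g) * resolventAt U z‖ ≤ δ'⁻¹ := by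
  refine ContinuousLinearMap.opNorm_le_bound _ (by positivity) fun v => ?_
  rw [mul_apply_eq_comp, _root_.sub_apply, one_apply_eq_self]
  exact norm_resolventAt_sub_cutoff_le U hg h01 hδ hplat hz hω v

/-- **`‖R(z) (1 - φ(H))‖ ≤ 1/δ'`** (the cutoff on the other side; functions of `H` commute with
`R(z)`). [cite: AmreinBoutetdeMonvelGeorgescu1996, Lemma 7.3.2 eq. (7.3.3)] -/
theorem norm_resolventAt_mul_one_sub_cutoff_le (U : OneParameterUnitaryGroup H) {g : 𝓢(ℝ, ℂ)}
    (hg : ∀ ξ, conj (g ξ) = g ξ) (h01 : ∀ ξ, 0 ≤ (g ξ).re ∧ (g ξ).re ≤ 1) {ω δ' : ℝ} (hδ : 0 < δ')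
    (hplat : ∀ x ∈ Set.Icc (ω - δ') (ω + δ'), g (x / (2 * Real.pi)) = 1) {z : ℂ} (hz : z.im ≠ 0)
    (hω : z.re = ω) :
    ‖resolventAt U z * (1 - U.fourierCalculus g)‖ ≤ δ'⁻¹ := by
  have e : resolventAt U z * (1 - U.fourierCalculus g) = (1 - U.fourierCalculus g) * resolventAt U z := by
    rw [mul_sub, sub_mul, mul_one, one_mul, fourierCalculus_resolventAt_comm U g hz]
  exact e ▸ norm_one_sub_cutoff_mul_resolventAt_le U hg h01 hδ hplat hz hω

/-! ## §3. Plateau cutoffs exist -/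

/-- **Plateau cutoffs**: for `l < l₁ ≤ r₁ < r` there is a real Schwartz cutoff `g`, admissible for
`HasMourreEstimateOn U A (Ioo l r) a` (`IsRealCutoffOn (Ioo l r) g`), with `0 ≤ g ≤ 1` real and
`g(x/2π) = 1` for all `x ∈ [l₁, r₁]` (a `ContDiffBump` centred at `(l₁ + r₁)/2` with inner radius
`> (r₁ - l₁)/2` and outer radius `< ` the distance to `l, r`, composed with `ξ ↦ 2πξ`). [folklore] -/
theorem exists_plateauCutoff {l l₁ r₁ r : ℝ} (hl : l < l₁) (h₁ : l₁ ≤ r₁) (hr : r₁ < r) :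
    ∃ g : 𝓢(ℝ, ℂ), IsRealCutoffOn (Set.Ioo l r) g ∧
      (∀ ξ, 0 ≤ (g ξ).re ∧ (g ξ).re ≤ 1 ∧ (g ξ).im = 0) ∧
      ∀ x ∈ Set.Icc l₁ r₁, g (x / (2 * Real.pi)) = 1 := by
  set m : ℝ := min (l₁ - l) (r - r₁) with hm
  have hm0 : 0 < m := lt_min (by linarith) (by linarith)
  have hmlr : m ≤ l₁ - l ∧ m ≤ r - r₁ := ⟨min_le_left _ _, min_le_right _ _⟩
  set c : ℝ := (l₁ + r₁) / 2 with hc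
  let b : ContDiffBump c := ⟨(r₁ - l₁) / 2 + m / 4, (r₁ - l₁) / 2 + m / 2, by linarith, by linarith⟩
  set F : ℝ → ℂ := fun x => ((b x : ℝ) : ℂ) with hF
  have hFs : HasCompactSupport F := b.hasCompactSupport.comp_left Complex.ofReal_zero
  have hFd : ContDiff ℝ ((⊤ : ℕ∞) : WithTop ℕ∞) F := Complex.ofRealCLM.contDiff.comp b.contDiff
  obtain ⟨g, hg⟩ := exists_schwartz_rescale F hFd hFs
  have h2π : (2 * Real.pi : ℝ) ≠ 0 := by positivity
  have hgF : ∀ w : ℝ, g w = F (2 * Real.pi * w) := fun w => by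
    have := hg (2 * Real.pi * w)
    rwa [mul_div_cancel_left₀ w h2π] at this
  have hcomp : ((g : 𝓢(ℝ, ℂ)) : ℝ → ℂ) = F ∘ fun ξ : ℝ => 2 * Real.pi * ξ := funext hgF
  refine ⟨g, ⟨fun ξ => ?_, ?_, ?_⟩, fun ξ => ?_, fun x hx => ?_⟩
  · rw [hgF, hF, Complex.conj_ofReal]
  · rw [hcomp]
    exact hFs.comp_homeomorph (Homeomorph.mulLeft₀ (2 * Real.pi) h2π)
  · rw [hcomp]
    refine (tsupport_comp_subset_preimage F (by fun_prop)).trans (Set.preimage_mono ?_)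
    calc tsupport F ⊆ tsupport (b : ℝ → ℝ) := tsupport_comp_subset Complex.ofReal_zero _
      _ = Metric.closedBall c b.rOut := b.tsupport_eq
      _ = Set.Icc (c - ((r₁ - l₁) / 2 + m / 2)) (c + ((r₁ - l₁) / 2 + m / 2)) :=
          Real.closedBall_eq_Icc
      _ ⊆ Set.Ioo l r := Set.Icc_subset_Ioo (by rw [hc]; linarith [hmlr.1]) (by rw [hc]; linarith [hmlr.2])
  · rw [hgF, hF]
    simp only [Complex.ofReal_re, Complex.ofReal_im]
    exact ⟨b.nonneg, b.le_one, trivial⟩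
  · rw [hg, hF]
    show ((b x : ℝ) : ℂ) = 1
    rw [b.one_of_mem_closedBall, Complex.ofReal_one]
    show x ∈ Metric.closedBall c ((r₁ - l₁) / 2 + m / 4)
    rw [Metric.mem_closedBall, Real.dist_eq, abs_le, hc]
    obtain ⟨hx1, hx2⟩ := hx
    constructor <;> linarith

/-! ## §4. Headline (registered helper stub) -/

/-- **Energy localisation for plateau cutoffs, headline form** (all binders explicit; registered
helper stub of `stub_mourreThresholdLAP`, S6-PLAN F3a.3–4): (1) for `l < l₁ ≤ r₁ < r` there is an
admissible real cutoff `g` on `(l, r)` with `0 ≤ g ≤ 1` and `g(x/2π) = 1` on `[l₁, r₁]`; (2) for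
any real `g` with `0 ≤ g ≤ 1` and `g(x/2π) = 1` on `[ω - δ', ω + δ']` (`δ' > 0`), every `z` with
`Re z = ω`, `Im z ≠ 0` and every `v`:
`‖R(z)v‖² - ‖g(H/2π) R(z) v‖² ≤ δ'⁻² ‖v‖²` and `‖R(z) v - g(H/2π) R(z) v‖ ≤ δ'⁻¹ ‖v‖`.
[cite: AmreinBoutetdeMonvelGeorgescu1996, Lemma 7.3.2 eq. (7.3.3)] -/
theorem energyLocalisation_of_plateauCutoff :
    (∀ (l l₁ r₁ r : ℝ), l < l₁ → l₁ ≤ r₁ → r₁ < r →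
      ∃ g : SchwartzMap ℝ ℂ,
        Literature.Analysis.UnboundedOperators.UnitaryRep.IsRealCutoffOn (Set.Ioo l r) g ∧
        (∀ ξ : ℝ, 0 ≤ (g ξ).re ∧ (g ξ).re ≤ 1 ∧ (g ξ).im = 0) ∧
        ∀ x ∈ Set.Icc l₁ r₁, g (x / (2 * Real.pi)) = 1) ∧
    ∀ (K : Type) [NormedAddCommGroup K] [InnerProductSpace ℂ K] [CompleteSpace K]
      (U : Literature.Analysis.UnboundedOperators.OneParameterUnitaryGroup K) (g : SchwartzMap ℝ ℂ)
      (ω δ' : ℝ) (z : ℂ),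
      (∀ ξ : ℝ, (starRingEnd ℂ) (g ξ) = g ξ) → (∀ ξ : ℝ, 0 ≤ (g ξ).re ∧ (g ξ).re ≤ 1) → 0 < δ' →
      (∀ x ∈ Set.Icc (ω - δ') (ω + δ'), g (x / (2 * Real.pi)) = 1) → z.im ≠ 0 → z.re = ω →
      ∀ v : K,
        ‖Summit.AtomisticToContinuum.FouriersLaw.Theorems.MourreDissolution.resolventAt U z v‖ ^ 2 -
            ‖U.fourierCalculus g
                (Summit.AtomisticToContinuum.FouriersLaw.Theorems.MourreDissolution.resolventAt U z v)‖ ^ 2 ≤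
          δ'⁻¹ ^ 2 * ‖v‖ ^ 2 ∧
        ‖Summit.AtomisticToContinuum.FouriersLaw.Theorems.MourreDissolution.resolventAt U z v -
            U.fourierCalculus g
              (Summit.AtomisticToContinuum.FouriersLaw.Theorems.MourreDissolution.resolventAt U z v)‖ ≤
          δ'⁻¹ * ‖v‖ := by
  refine ⟨fun l l₁ r₁ r hl h₁ hr => exists_plateauCutoff hl h₁ hr, ?_⟩
  intro K _ _ _ U g ω δ' z hg h01 hδ hplat hz hω v
  exact ⟨norm_sq_resolventAt_sub_norm_sq_cutoff_le U hg h01 hδ hplat hz hω v,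
    norm_resolventAt_sub_cutoff_le U hg h01 hδ hplat hz hω v⟩

end Summit.AtomisticToContinuum.FouriersLaw.Theorems.MourreDissolution
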